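/-
Copyright (c) 2026 the pub-hodgecm-mathlib formalisation cell (harness21).  Prover seat hodgecm-mathlib-K2Liu-p14 (g2), Track B «K2-LIT»,
#184♮ = hLiu418 = `stmt-HodgeConjecture-24832`; #42F′ Road I, A7-val ROAD (σ) brick V3 (O2) FILE B (K2Liu-p09 (g6) memo 0ec4b1215f8a4fcc §3c; LEAD «M-158d»;
interface K2Liu-p09 11:27:21Z (q3): «the seven orbits on the rank strata `{rk A = i, rk B = j, BA = 0}` of `M_{3×2}(F) × M_{2×3}(F)` under `(g, a₁, a₂)`, openness of
the filtration by rank semicontinuity»).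
-/
import Summits.HodgeConjecture.HodgeConjecture.Theorems.K2LiuLinearPairOrbit   -- FILE A: `exists_linearEquiv_conj_of_finrank_range_eq`
import Mathlib.LinearAlgebra.Matrix.Rank
import Mathlib.LinearAlgebra.Matrix.ToLin
import Mathlib.LinearAlgebra.Matrix.GeneralLinearGroup.Defs
import Mathlib.Topology.Instances.Matrix
import Mathlib.Topology.Algebra.Ring.Basic
import HarnessLib

/-!
# Crux `HLiu418`, A7-val road (σ), brick V3 (O2) FILE B: THE SPLIT NULL CONE `{BA = 0} ⊆ M_{m×n} × M_{k×m}` — EVERY RANK STRATUM IS ONE ORBIT OF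
# `GL_m × GL_n × GL_k`, THE RANK CONSTRAINT `rk A + rk B ≤ m`, AND THE OPENNESS OF THE RANK FILTRATION (`3 × 2` ∕ `2 × 3`)

Cell `hodgecm-mathlib`, crux item hLiu418 = `stmt-HodgeConjecture-24832`; squad K2 ∕ K2Liu; prover K2Liu-p14 (g2).  THEOREMS ONLY (no `def`, no instance, no
notation, no named-fact hypothesis, no `sorry`); lane `--supports stmt-HodgeConjecture-24832 --as helper`.  Generic over a field (§1–§2) ∕ a Hausdorff topological field (§3).

SETTING (K2Liu-p09 (g6) §3c).  At a SPLIT place `v` of `L⁺` (`L ⊗ L⁺_v = F_v × F_v`) the auxiliary hermitian 3-space gives `U(V′_v) ≅ GL₃(F_v)` and the Schrödinger space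
`X ≅ M_{3×2}(F_v) × M_{2×3}(F_v)` with moment map `Q(A, B) = BA ∈ M₂(F_v)`; `GL₃ × GL₂ × GL₂` acts by `A ↦ g A a₁⁻¹`, `B ↦ a₂ B g⁻¹`.  The null cone `{BA = 0}` is the
union of the rank strata `O_{ij} = {rk A = i, rk B = j}`, `(i, j) ∈ {(0,0), (1,0), (0,1), (2,0), (1,1), (0,2), (2,1), (1,2)}` (`i, j ≤ 2`, `i + j ≤ 3`).
* §1 **`exists_gl_conj_of_rank_eq`** — TRANSITIVITY ON EVERY STRATUM AT ONCE (any sizes `m, n, k`, any field): `BA = 0 = B′A′`, `rk A = rk A′`, `rk B = rk B′` ⇒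
  `∃ g a₁ a₂` invertible with `g A a₁⁻¹ = A′`, `a₂ B g⁻¹ = B′` (FILE A `exists_linearEquiv_conj_of_finrank_range_eq` read in matrices via ★ `Matrix.toLin'`).
* §2 **`rank_add_rank_le_of_mul_eq_zero`** (`BA = 0 ⇒ rk A + rk B ≤ m`: `range A ≤ ker B`), `rank_le_two_…` — the strata are exactly the eight above.
* §3 (`3 × 2`, Hausdorff topological field `F`): **`rank_eq_two_iff_exists_minor_ne_zero`** (rank `2` ⟺ some `2 × 2` minor `≠ 0`), **`isOpen_setOf_rank_eq_two`**,
  `isOpen_setOf_transpose_rank_eq_two'`∕**`isOpen_setOf_rank_eq_two'`** (`2 × 3`, by transpose), `isOpen_setOf_ne_zero` — whence the filtration of §3c: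
  `O₂₁ ∪ O₁₂ = 𝒩 ∩ ({rk A = 2} ∪ {rk B = 2})` is open in `𝒩`, then `O₂₀, O₀₂, O₁₁` are cut out of the next closed stratum by the open conditions `rk A = 2`, `rk B = 2`,
  `A ≠ 0 ≠ B`, and `O₁₀, O₀₁` of the last by `A ≠ 0`, `B ≠ 0` (the consumer intersects; stabiliser elements per orbit are chosen in V5-split's census).
References: [KudlaRallis1990, §2]; [Rallis1984]; [KudlaSweet1997, §2]; [BernsteinZelevinsky1976, §1.5].
HONEST LABEL.  Count-neutral helper: `HC_CM` is proved only modulo the 7 printed citations (2 remaining named inputs: hLiu418 = `stmt-HodgeConjecture-24832`,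
h413 = `stmt-HodgeConjecture-24833`) until rung 0 closes.
-/

set_option autoImplicit false
set_option linter.dupNamespace false -- the mandated namespace repeats `HodgeConjecture.HodgeConjecture`

namespace Summit.HodgeConjecture.HodgeConjecture.Cruxes.HLiu418.K2LiuNullConeOrbitsSplit

open Module Matrix
open Summit.HodgeConjecture.HodgeConjecture.Cruxes.HLiu418.K2LiuLinearPairOrbit

/-! ## §1 Every rank stratum of `{BA = 0}` is one orbit of `GL_m × GL_n × GL_k` -/

section Transitivity

variable {F : Type*} [Field F] {m n k : Type*} [Fintype m] [DecidableEq m] [Fintype n] [DecidableEq n] [Fintype k] [DecidableEq k]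

/-- the invertible matrix of a linear automorphism of `ι → F` (as a unit of the matrix ring, inverse = matrix of the inverse). [folklore] -/
theorem exists_gl_coe_eq_toMatrix' {ι : Type*} [Fintype ι] [DecidableEq ι] (e : (ι → F) ≃ₗ[F] (ι → F)) :
    ∃ g : GL ι F, (g : Matrix ι ι F) = LinearMap.toMatrix' (e : (ι → F) →ₗ[F] (ι → F)) ∧
      ((g⁻¹ : GL ι F) : Matrix ι ι F) = LinearMap.toMatrix' (e.symm : (ι → F) →ₗ[F] (ι → F)) := by
  have h1 : (e : (ι → F) →ₗ[F] (ι → F)) ∘ₗ (e.symm : (ι → F) →ₗ[F] (ι → F)) = LinearMap.id := LinearMap.ext fun x => e.apply_symm_apply x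
  have h2 : (e.symm : (ι → F) →ₗ[F] (ι → F)) ∘ₗ (e : (ι → F) →ₗ[F] (ι → F)) = LinearMap.id := LinearMap.ext fun x => e.symm_apply_apply x
  refine ⟨⟨LinearMap.toMatrix' (e : (ι → F) →ₗ[F] (ι → F)), LinearMap.toMatrix' (e.symm : (ι → F) →ₗ[F] (ι → F)), ?_, ?_⟩, rfl, rfl⟩
  · rw [← LinearMap.toMatrix'_comp, h1, LinearMap.toMatrix'_id]
  · rw [← LinearMap.toMatrix'_comp, h2, LinearMap.toMatrix'_id]

omit [Fintype m] [DecidableEq m] [DecidableEq n] [Fintype k] [DecidableEq k] in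
/-- the rank of a matrix is the dimension of the range of its `mulVecLin` (definitional). [folklore] -/
theorem rank_eq_finrank_range_mulVecLin (A : Matrix m n F) : A.rank = finrank F (LinearMap.range A.mulVecLin) := rfl

/-- **EVERY RANK STRATUM OF THE SPLIT NULL CONE IS ONE ORBIT.**  For `A, A′ ∈ M_{m×n}(F)`, `B, B′ ∈ M_{k×m}(F)` with `B A = 0 = B′ A′`, `rk A = rk A′` and `rk B = rk B′`
there are `g ∈ GL_m(F)`, `a₁ ∈ GL_n(F)`, `a₂ ∈ GL_k(F)` with `g A a₁⁻¹ = A′` and `a₂ B g⁻¹ = B′` (the action `A ↦ g A a₁⁻¹`, `B ↦ a₂ B g⁻¹` of K2Liu-p09's §3c;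
for `(m, n, k) = (3, 2, 2)` these are the eight strata `O_{ij}` of `{BA = 0}`, each ONE orbit of `GL₃ × GL₂ × GL₂`). [cite: KudlaRallis1990, §2] [cite: KudlaSweet1997, §2] -/
theorem exists_gl_conj_of_rank_eq (A A' : Matrix m n F) (B B' : Matrix k m F) (hBA : B * A = 0) (hBA' : B' * A' = 0)
    (hrA : A.rank = A'.rank) (hrB : B.rank = B'.rank) :
    ∃ (g : GL m F) (a₁ : GL n F) (a₂ : GL k F),
      (g : Matrix m m F) * A * ((a₁⁻¹ : GL n F) : Matrix n n F) = A' ∧ (a₂ : Matrix k k F) * B * ((g⁻¹ : GL m F) : Matrix m m F) = B' := by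
  -- the linear maps
  have h0 : B.mulVecLin ∘ₗ A.mulVecLin = 0 := by rw [← Matrix.mulVecLin_mul, hBA, Matrix.mulVecLin_zero]
  have h0' : B'.mulVecLin ∘ₗ A'.mulVecLin = 0 := by rw [← Matrix.mulVecLin_mul, hBA', Matrix.mulVecLin_zero]
  rw [rank_eq_finrank_range_mulVecLin, rank_eq_finrank_range_mulVecLin] at hrA hrB
  obtain ⟨eU, eV, eW, hV, hW⟩ := exists_linearEquiv_conj_of_finrank_range_eq A.mulVecLin A'.mulVecLin B.mulVecLin B'.mulVecLin h0 h0' hrA hrB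
  obtain ⟨g, hg, hg'⟩ := exists_gl_coe_eq_toMatrix' eV
  obtain ⟨a₁, ha₁, ha₁'⟩ := exists_gl_coe_eq_toMatrix' eU
  obtain ⟨a₂, ha₂, ha₂'⟩ := exists_gl_coe_eq_toMatrix' eW
  -- read the two intertwining relations in matrices
  have hAm : LinearMap.toMatrix' A.mulVecLin = A := by rw [← Matrix.toLin'_apply', LinearMap.toMatrix'_toLin']
  have hAm' : LinearMap.toMatrix' A'.mulVecLin = A' := by rw [← Matrix.toLin'_apply', LinearMap.toMatrix'_toLin']
  have hBm : LinearMap.toMatrix' B.mulVecLin = B := by rw [← Matrix.toLin'_apply', LinearMap.toMatrix'_toLin']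
  have hBm' : LinearMap.toMatrix' B'.mulVecLin = B' := by rw [← Matrix.toLin'_apply', LinearMap.toMatrix'_toLin']
  have hV' := congrArg LinearMap.toMatrix' hV
  rw [LinearMap.toMatrix'_comp, LinearMap.toMatrix'_comp, hAm, hAm', ← hg, ← ha₁] at hV'
  have hW' := congrArg LinearMap.toMatrix' hW
  rw [LinearMap.toMatrix'_comp, LinearMap.toMatrix'_comp, hBm, hBm', ← hg, ← ha₂] at hW'
  -- `g A = A′ a₁` and `a₂ B = B′ g`
  refine ⟨g, a₁, a₂, ?_, ?_⟩
  · rw [hV', Matrix.mul_assoc, ← Units.val_mul, mul_inv_cancel, Units.val_one, Matrix.mul_one]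
  · rw [hW', Matrix.mul_assoc, ← Units.val_mul, mul_inv_cancel, Units.val_one, Matrix.mul_one]

/-- the plain form without inverses: `g A = A′ a₁` and `a₂ B = B′ g`. [cite: KudlaRallis1990, §2] -/
theorem exists_gl_mul_eq_mul_of_rank_eq (A A' : Matrix m n F) (B B' : Matrix k m F) (hBA : B * A = 0) (hBA' : B' * A' = 0)
    (hrA : A.rank = A'.rank) (hrB : B.rank = B'.rank) :
    ∃ (g : GL m F) (a₁ : GL n F) (a₂ : GL k F), (g : Matrix m m F) * A = A' * (a₁ : Matrix n n F) ∧ (a₂ : Matrix k k F) * B = B' * (g : Matrix m m F) := by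
  obtain ⟨g, a₁, a₂, h1, h2⟩ := exists_gl_conj_of_rank_eq A A' B B' hBA hBA' hrA hrB
  refine ⟨g, a₁, a₂, ?_, ?_⟩
  · rw [← h1, Matrix.mul_assoc, Matrix.mul_assoc, ← Units.val_mul, inv_mul_cancel, Units.val_one, Matrix.mul_one]
  · rw [← h2, Matrix.mul_assoc, Matrix.mul_assoc, ← Units.val_mul, inv_mul_cancel, Units.val_one, Matrix.mul_one]

end Transitivity

/-! ## §2 The rank constraint: the strata of `{BA = 0}` -/

section Strata

variable {F : Type*} [Field F] {m n k : Type*} [Fintype m] [Fintype n]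

/-- **`BA = 0 ⇒ rk A + rk B ≤ m`** (`range A ≤ ker B` and rank–nullity for `B`). [cite: KudlaRallis1990, §2] -/
theorem rank_add_rank_le_of_mul_eq_zero (A : Matrix m n F) (B : Matrix k m F) (hBA : B * A = 0) :
    A.rank + B.rank ≤ Fintype.card m := by
  classical
  have h0 : B.mulVecLin ∘ₗ A.mulVecLin = 0 := by rw [← Matrix.mulVecLin_mul, hBA, Matrix.mulVecLin_zero]
  have hle : LinearMap.range A.mulVecLin ≤ LinearMap.ker B.mulVecLin := LinearMap.range_le_ker_iff.2 h0
  have h1 := Submodule.finrank_mono hle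
  have h2 := B.mulVecLin.finrank_range_add_finrank_ker
  rw [Module.finrank_fintype_fun_eq_card] at h2
  change finrank F (LinearMap.range A.mulVecLin) + finrank F (LinearMap.range B.mulVecLin) ≤ _
  omega

/-- the strata of the `3 × 2` ∕ `2 × 3` null cone: `rk A ≤ 2`, `rk B ≤ 2`, `rk A + rk B ≤ 3` — i.e. `(rk A, rk B)` is one of
`(0,0), (1,0), (0,1), (2,0), (1,1), (0,2), (2,1), (1,2)`. [cite: KudlaRallis1990, §2] -/
theorem rank_mem_strata (A : Matrix (Fin 3) (Fin 2) F) (B : Matrix (Fin 2) (Fin 3) F) (hBA : B * A = 0) :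
    A.rank ≤ 2 ∧ B.rank ≤ 2 ∧ A.rank + B.rank ≤ 3 := by
  refine ⟨A.rank_le_width, B.rank_le_height, ?_⟩
  have := rank_add_rank_le_of_mul_eq_zero A B hBA
  rwa [Fintype.card_fin] at this

end Strata

/-! ## §3 Openness of the rank filtration (`3 × 2` and `2 × 3`) -/

section Openness

variable {F : Type*} [Field F]

/-- the `2 × 2` minor of rows `i, j` of a `3 × 2` matrix. (We spell it out; no definition.) [folklore] -/
theorem det_submatrix_pair (A : Matrix (Fin 3) (Fin 2) F) (i j : Fin 3) :
    (A.submatrix ![i, j] id).det = A i 0 * A j 1 - A i 1 * A j 0 := by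
  rw [Matrix.det_fin_two]
  simp [Matrix.submatrix_apply]

/-- a non-vanishing `2 × 2` minor forces rank `2`. [folklore] -/
theorem rank_eq_two_of_minor_ne_zero (A : Matrix (Fin 3) (Fin 2) F) {i j : Fin 3} (h : A i 0 * A j 1 - A i 1 * A j 0 ≠ 0) : A.rank = 2 := by
  apply le_antisymm A.rank_le_width
  have hsub : (A.submatrix ![i, j] id).rank = 2 := by
    rw [Matrix.rank_of_isUnit _ (by rw [Matrix.isUnit_iff_isUnit_det, det_submatrix_pair, isUnit_iff_ne_zero]; exact h), Fintype.card_fin]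
  exact hsub.symm.trans_le (Matrix.rank_submatrix_le A ![i, j] id)

/-- the columns of a rank-`2` `3 × 2` matrix are linearly independent. [folklore] -/
theorem linearIndependent_col_of_rank_eq_two (A : Matrix (Fin 3) (Fin 2) F) (h : A.rank = 2) : LinearIndependent F A.col := by
  rw [linearIndependent_iff_card_eq_finrank_span, Fintype.card_fin, Set.finrank, ← Matrix.rank_eq_finrank_span_cols, h]

/-- rank `2` forces a non-vanishing `2 × 2` minor (an independent pair of columns in `F³`). [folklore] -/
theorem exists_minor_ne_zero_of_rank_eq_two (A : Matrix (Fin 3) (Fin 2) F) (h : A.rank = 2) :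
    ∃ i j : Fin 3, A i 0 * A j 1 - A i 1 * A j 0 ≠ 0 := by
  by_contra hall'
  have hall : ∀ i j : Fin 3, A i 0 * A j 1 - A i 1 * A j 0 = 0 := fun i j => by
    by_contra hne
    exact hall' ⟨i, j, hne⟩
  have hli := linearIndependent_col_of_rank_eq_two A h
  have hcol : A.col = ![A.col 0, A.col 1] := by
    funext t
    fin_cases t <;> rfl
  rw [hcol, LinearIndependent.pair_iff] at hli
  -- the column `A.col 0` is non-zero
  have h0 : A.col 0 ≠ 0 := by
    intro h0
    have := (hli 1 0 (by rw [h0, smul_zero, zero_smul, add_zero])).1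
    exact one_ne_zero this
  obtain ⟨i, hi⟩ : ∃ i, A i 0 ≠ 0 := by
    by_contra hnone
    apply h0
    funext t
    by_contra hne
    exact hnone ⟨t, hne⟩
  -- the relation `A i 1 • col 0 − A i 0 • col 1 = 0` from the vanishing minors with row `i`
  have hrel : A i 1 • A.col 0 + (-A i 0) • A.col 1 = 0 := by
    funext j
    have hm := hall j i
    simp only [Pi.add_apply, Pi.smul_apply, Matrix.col_apply, smul_eq_mul, Pi.zero_apply, neg_mul]
    rw [mul_comm (A i 1) (A j 0), sub_eq_zero.1 hm, mul_comm (A j 1) (A i 0), add_neg_cancel]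
  have := (hli (A i 1) (-A i 0) hrel).2
  exact hi (neg_eq_zero.1 this)

/-- **rank `2` ⟺ some `2 × 2` minor is non-zero** (`3 × 2` matrices over a field). [folklore] -/
theorem rank_eq_two_iff_exists_minor_ne_zero (A : Matrix (Fin 3) (Fin 2) F) :
    A.rank = 2 ↔ ∃ i j : Fin 3, A i 0 * A j 1 - A i 1 * A j 0 ≠ 0 :=
  ⟨exists_minor_ne_zero_of_rank_eq_two A, fun ⟨_, _, h⟩ => rank_eq_two_of_minor_ne_zero A h⟩

variable [TopologicalSpace F] [IsTopologicalRing F] [T2Space F]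

/-- **RANK SEMICONTINUITY, `3 × 2`: `{A | rk A = 2}` is open** (a union of complements of zero sets of `2 × 2` minors). [cite: KudlaRallis1990, §2] -/
theorem isOpen_setOf_rank_eq_two : IsOpen {A : Matrix (Fin 3) (Fin 2) F | A.rank = 2} := by
  have hset : {A : Matrix (Fin 3) (Fin 2) F | A.rank = 2} = ⋃ i : Fin 3, ⋃ j : Fin 3, {A | A i 0 * A j 1 - A i 1 * A j 0 ≠ 0} := by
    ext A
    simp only [Set.mem_setOf_eq, Set.mem_iUnion, rank_eq_two_iff_exists_minor_ne_zero]
  rw [hset]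
  refine isOpen_iUnion fun i => isOpen_iUnion fun j => ?_
  have hc : Continuous fun A : Matrix (Fin 3) (Fin 2) F => A i 0 * A j 1 - A i 1 * A j 0 :=
    (((continuous_apply_apply i 0).mul (continuous_apply_apply j 1)).sub ((continuous_apply_apply i 1).mul (continuous_apply_apply j 0)))
  exact isOpen_compl_singleton.preimage hc

/-- **RANK SEMICONTINUITY, `2 × 3`: `{B | rk B = 2}` is open** (transpose of the `3 × 2` statement, ★ `Matrix.rank_transpose`). [cite: KudlaRallis1990, §2] -/
theorem isOpen_setOf_rank_eq_two' : IsOpen {B : Matrix (Fin 2) (Fin 3) F | B.rank = 2} := by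
  have hset : {B : Matrix (Fin 2) (Fin 3) F | B.rank = 2} = (fun B : Matrix (Fin 2) (Fin 3) F => Bᵀ) ⁻¹' {A : Matrix (Fin 3) (Fin 2) F | A.rank = 2} := by
    ext B
    simp only [Set.mem_setOf_eq, Set.mem_preimage, Matrix.rank_transpose]
  rw [hset]
  exact isOpen_setOf_rank_eq_two.preimage (Continuous.matrix_transpose continuous_id)

omit [IsTopologicalRing F] in
/-- `{A | A ≠ 0}` is open (`rk ≥ 1`). [folklore] -/
theorem isOpen_setOf_ne_zero {ι κ : Type*} [Fintype ι] [Fintype κ] : IsOpen {A : Matrix ι κ F | A ≠ 0} :=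
  isOpen_ne

/-- **THE OPEN STRATUM**: `{(A, B) | rk A = 2 ∨ rk B = 2}` is open in `M_{3×2} × M_{2×3}` — intersected with the null cone it is `O₂₁ ∪ O₁₂ ∪ O₂₀ ∪ O₀₂`, and with
`{A ≠ 0} × {B ≠ 0}` (open) it is `O₂₁ ∪ O₁₂`. [cite: KudlaRallis1990, §2] -/
theorem isOpen_setOf_rank_eq_two_or : IsOpen {p : Matrix (Fin 3) (Fin 2) F × Matrix (Fin 2) (Fin 3) F | p.1.rank = 2 ∨ p.2.rank = 2} :=
  (isOpen_setOf_rank_eq_two.preimage continuous_fst).union (isOpen_setOf_rank_eq_two'.preimage continuous_snd)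

omit [IsTopologicalRing F] in
/-- `{(A, B) | A ≠ 0 ∧ B ≠ 0}` is open. [folklore] -/
theorem isOpen_setOf_ne_zero_and : IsOpen {p : Matrix (Fin 3) (Fin 2) F × Matrix (Fin 2) (Fin 3) F | p.1 ≠ 0 ∧ p.2 ≠ 0} :=
  (isOpen_ne.preimage continuous_fst).inter (isOpen_ne.preimage continuous_snd)

end Openness

end Summit.HodgeConjecture.HodgeConjecture.Cruxes.HLiu418.K2LiuNullConeOrbitsSplit
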